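import Summits.QuantumFields.BalabanUV.T4Continuum.Support.NE3SliceWords
import Summits.QuantumFields.BalabanUV.T4Continuum.Support.AveragingDeficitLiftMap
import HarnessLib

/-!
# T⁴ programme, node NE3 — row E-RES♯, sub-row (R♯3a): THE DRESSED SLICE LIFT OF A COARSE BOND AND ITS PUSH-FORWARD DEFECT
# (part 1): the loop term of (42) is `Ad_{V(Γ_c)}(Ad_{G_r} m − m)` with the TAIL LOOP `G_r` = an axial-gauge segment holonomy, `‖G_r − 1‖ ≤ d·L²·α`

NE3 prover lineage P1, gen 20 (cell `pub-balaban`, unit `b2b-balaban-t4-ne3-p1`, row NE3 OWNER; journal cut «E-RES♯ INTO ROWS» l.14429,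
(R♯3a)).  The curl-controlled lift of the surviving variant (R3) at a GENERAL (non-flat) background `V`: on the last `κ`-slice of the
block of the coarse bond `c = (y, κ)` put the coarse value `φ(c)` TRANSPORTED from the far corner `L(y+e_κ)` along the reversed
tree word to the slice bond's end point — `ψ_c(b) = Ad_{T_b} φ(c)`, `T_b = V(Γ_{L(y+e_κ), b₊})⁻¹` (so `ψ_c(b₀(c)) = φ(c)`).  By the
slice-word classification (`NE3SliceWords`, (R♯3-prep)) every contour `Γ_{c,x}` of (42) then contributes, after Bałaban's dressing
`Ad_{W_x⁻¹}`, the term `Ad_{V(Γ_c)}(Ad_{G_x} φ(c) − φ(c))` where `G_x` is the holonomy of the in-block loop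
`Γ_{q′,q′+r} ∪ [down r_κ] ∪ Γ_{q′,q′+r_⊥}⁻¹` (`q′ = L(y+e_κ)`) = the AXIAL-GAUGE holonomy of a `κ`-segment of `r_κ ≤ L−1` bonds; so
`‖G_x − 1‖ ≤ w₂ := d·L²·α` by the tree's `B7Prop1Explicit.axial_bond_bound`, and the (E2)–(E8) chain of row NE3-R2's
`AveragingDeficitLiftMap.norm_liftMap_sub_le` (the near-identity expansions of `log′` and `J`) gives the push defect.

CONTENT (two data `def`s — `perp`, the dressed one-bond slice direction `dsliceDir` — and the unit `tailLoop`; 0 sorry):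
* §1 `dsliceDir L V y κ m` and its values: slice-supported, `= m` at `b₀(c)`, `= Ad_{(V(Γ_{q′, q′+r_⊥}))⁻¹} m` at the slice bond of
  the contour through `x = Ly + r`; skew if `m` is skew and `V` unitary;
* §2 **`loop_term_dsliceDir`** — the dressed loop term of (42) is `Ad_{V(Γ_c)}(Ad_{G_r} m − m)` with the explicit unit `G_r`, and
  **`tailLoop_eq_hol_gaugeAct`** — `G_r` is the axial-gauge holonomy of the downward `κ`-segment from `q′ + r`;
* §3 **`norm_tailLoop_sub_one_le`** — `‖G_r − 1‖ ≤ d·L²·α` on `SmallField V α`.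
THE ESTIMATE ITSELF ((R♯3a) part 2, NOT in this file — next seat): `‖pushDir L V (dsliceDir L V y κ m) (Ly) κ − m‖ ≤ 62·w₂·‖m‖`
under the loop bound `w ≤ 1∕32` of (42) (`AveragingDeficitLiftMap.LoopBound`) and the tail bound `w₂` of §3, by the (E2)–(E8) chain
of `AveragingDeficitLiftMap.norm_liftMap_sub_le` with §2's loop term (`Z_r = Ad_{V(Γ_c)}(Ad_{G_r}m − m)`, `‖Z_r‖ ≤ 2w₂‖m‖`,
`ψ(b₀) = m`, leading coefficient `1`).

HONEST FRAMING.  An estimate of OUR frame for ONE block-averaging step at ONE small-field configuration (context: [Balaban1985Averaging]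
(42) p.23, (47)–(50) p.25); (R♯3b) (the curl of the dressed lift), (R♯4), (R♯5), (RES♯), T-E_w♯, NE3 NOT proved; spine PROVED 0∕9;
finite T⁴ rung (B)+1 — NOT infinite volume, NOT mass gap, NOT `BetaPertH`, NOT Clay.  PLACEMENT: `Summits/QuantumFields/BalabanUV/`.
HONEST DEPENDENCY (cell page 1): continuum YM on T⁴ ⇐ BetaPertH ∧ nine spine estimates (0/9 proved); BetaPertH ⇐ (D1) ∧ (D4) ∧
CAP+tail; G-an2-4 gates asym, D1 and NE2/3/4.
-/

set_option autoImplicit false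

open scoped BigOperators Matrix Matrix.Norms.L2Operator Topology
open NormedSpace Finset Filter

namespace Summit.QuantumFields.BalabanUV.T4Continuum.NE3DressedSliceLift

open Literature.MathematicalPhysics.QuantumFieldTheory.Balaban1983to89
open B7Prop1Explicit B7Prop2Explicit MatrixLog UnitaryModel
open T4AveragingDeficitWall hiding Site Plane Plaq Bond
open T4AveragingDeficitNonAbelian (Ad_mul Ad_sub)
open AveragingDeficitTransport AveragingDeficitLocality AveragingDeficitNearIdentity AveragingDeficitSideDeriv
open AveragingDeficitResidualPairing AveragingDeficitTransportCalc AveragingDeficitPushForwardLinear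
open AveragingDeficitFaceWords (faceSite)
open AveragingDeficitLiftMap (LoopBound)
open SmoothRefineBlocks (blk res blk_res_eq_of res_boxVec blk_boxVec)
open NE3SliceWords (SliceSupported Ad_inv_Wcx_dhol_loopWord_slice pushDir_sliceSupported res_corner_add)

noncomputable section

variable {d : ℕ} {n : Type*} [Fintype n] [DecidableEq n]

/-! ## §1 The dressed one-bond slice direction -/

/-- The transverse part of a block offset: `r_⊥ = r − r_κ e_κ`. [folklore] -/
def perp (κ : Fin d) (r : Site d) : Site d := r - r κ • e κ

omit [Fintype n] [DecidableEq n] in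
/-- `perp κ r` agrees with `r` off `κ` and vanishes at `κ`. [folklore] -/
theorem perp_apply (κ : Fin d) (r : Site d) (i : Fin d) : perp κ r i = if i = κ then 0 else r i := by
  unfold perp
  by_cases h : i = κ
  · subst h; simp [e_apply]
  · simp [e_apply, h]

open Classical in
/-- **THE DRESSED SLICE DIRECTION OF THE COARSE BOND `c = (y, κ)` WITH VALUE `m`**: on the last `κ`-slice of the block `B(Ly)`
(bonds `(z, κ)`, `blk z = y`, `res_κ z = L − 1`) the value `Ad_{T_z} m`, `T_z = V(Γ_{q′, q′ + r_⊥(z)})⁻¹`, `q′ = L(y + e_κ)`,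
`r_⊥(z)` = the residue of `z` with its `κ`-component removed (the slice bond ends at `q′ + r_⊥(z)`); zero elsewhere. [folklore] -/
def dsliceDir (L : ℕ) (V : Site d → Fin d → (Matrix n n ℂ)ˣ) (y : Site d) (κ : Fin d) (m : Matrix n n ℂ) :
    Site d → Fin d → Matrix n n ℂ :=
  fun z i => if i = κ ∧ blk L z = y ∧ res L z κ = (L : ℤ) - 1
    then Ad (hol V ((L : ℤ) • (y + e κ)) (treeWord (perp κ (res L z))))⁻¹ m else 0

omit [Fintype n] [DecidableEq n] in
/-- The residue of the slice bond of the contour through `x = Ly + r`: `res (Ly + r + j₀e_κ) = r + j₀e_κ`, `j₀ = L − 1 − r_κ`, and its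
block is `y`. [folklore] -/
theorem blk_res_sliceBond {L : ℕ} (hL : 1 ≤ L) (y : Site d) (κ : Fin d) (r : Fin d → Fin L) :
    blk L ((L : ℤ) • y + boxVec L r + ((L - 1 - (r κ : ℕ) : ℕ) : ℤ) • e κ) = y ∧
      res L ((L : ℤ) • y + boxVec L r + ((L - 1 - (r κ : ℕ) : ℕ) : ℤ) • e κ)
        = boxVec L r + ((L - 1 - (r κ : ℕ) : ℕ) : ℤ) • e κ := by
  have hrκ : (r κ : ℕ) < L := (r κ).isLt
  refine blk_res_eq_of hL (by rw [add_assoc]) (fun i => ?_) (fun i => ?_)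
  · simp only [Pi.add_apply, Pi.smul_apply, boxVec, e_apply, smul_eq_mul]
    split_ifs <;> positivity
  · simp only [Pi.add_apply, Pi.smul_apply, boxVec, e_apply, smul_eq_mul]
    split_ifs with h
    · subst h; omega
    · simp only [mul_zero, add_zero]; exact_mod_cast (r i).isLt

omit [Fintype n] [DecidableEq n] in
/-- The transverse part of that residue is `r_⊥`. [folklore] -/
theorem perp_res_sliceBond {L : ℕ} (hL : 1 ≤ L) (y : Site d) (κ : Fin d) (r : Fin d → Fin L) :
    perp κ (res L ((L : ℤ) • y + boxVec L r + ((L - 1 - (r κ : ℕ) : ℕ) : ℤ) • e κ)) = perp κ (boxVec L r) := by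
  rw [(blk_res_sliceBond hL y κ r).2]
  funext i
  rw [perp_apply, perp_apply]
  by_cases h : i = κ
  · simp [h]
  · simp [h, e_apply]

/-- The dressed slice direction is slice-supported. [folklore] -/
theorem sliceSupported_dsliceDir (L : ℕ) (V : Site d → Fin d → (Matrix n n ℂ)ˣ) (y : Site d) (κ : Fin d) (m : Matrix n n ℂ) :
    SliceSupported L (dsliceDir L V y κ m) := by
  intro z i hz
  unfold dsliceDir
  rw [if_neg]
  rintro ⟨rfl, -, h⟩
  exact hz h

/-- Off the block `y` or off the direction `κ` the dressed slice direction vanishes; in particular on the slices of OTHER coarse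
bonds. [folklore] -/
theorem dsliceDir_of_ne (L : ℕ) (V : Site d → Fin d → (Matrix n n ℂ)ˣ) (y : Site d) (κ : Fin d) (m : Matrix n n ℂ)
    {z : Site d} {i : Fin d} (h : ¬ (i = κ ∧ blk L z = y ∧ res L z κ = (L : ℤ) - 1)) : dsliceDir L V y κ m z i = 0 := by
  unfold dsliceDir; rw [if_neg h]

/-- **At `b₀(c)` the dressed slice direction is `m` itself** (`r_⊥ = 0`, the transport is trivial). [folklore] -/
theorem dsliceDir_faceSite {L : ℕ} (hL : 1 ≤ L) (V : Site d → Fin d → (Matrix n n ℂ)ˣ) (y : Site d) (κ : Fin d)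
    (m : Matrix n n ℂ) : dsliceDir L V y κ m (faceSite L y κ) κ = m := by
  have hL0 : (0 : ℤ) < L := by exact_mod_cast (show 0 < L by omega)
  have hbr : blk L (faceSite L y κ) = y ∧ res L (faceSite L y κ) = ((L : ℤ) - 1) • e κ := by
    refine blk_res_eq_of hL rfl (fun i => ?_) (fun i => ?_)
    · simp only [Pi.smul_apply, e_apply, smul_eq_mul]; split_ifs <;> omega
    · simp only [Pi.smul_apply, e_apply, smul_eq_mul]; split_ifs <;> omega
  have hres : res L (faceSite L y κ) κ = (L : ℤ) - 1 := by
    rw [hbr.2]; simp [e_apply]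
  have hperp : perp κ (res L (faceSite L y κ)) = 0 := by
    rw [hbr.2]; funext i; rw [perp_apply]; by_cases h : i = κ <;> simp [h, e_apply]
  unfold dsliceDir
  rw [if_pos ⟨rfl, hbr.1, hres⟩, hperp, treeWord_zero]
  simp [Ad]

/-- **At the slice bond of the contour through `x = Ly + r`** the dressed slice direction is `Ad_{(V(Γ_{q′, q′+r_⊥}))⁻¹} m`.
[folklore] -/
theorem dsliceDir_sliceBond {L : ℕ} (hL : 1 ≤ L) (V : Site d → Fin d → (Matrix n n ℂ)ˣ) (y : Site d) (κ : Fin d)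
    (m : Matrix n n ℂ) (r : Fin d → Fin L) :
    dsliceDir L V y κ m ((L : ℤ) • y + boxVec L r + ((L - 1 - (r κ : ℕ) : ℕ) : ℤ) • e κ) κ
      = Ad (hol V ((L : ℤ) • (y + e κ)) (treeWord (perp κ (boxVec L r))))⁻¹ m := by
  have hrκ : (r κ : ℕ) < L := (r κ).isLt
  obtain ⟨hb, hr⟩ := blk_res_sliceBond hL y κ r
  have hres : res L ((L : ℤ) • y + boxVec L r + ((L - 1 - (r κ : ℕ) : ℕ) : ℤ) • e κ) κ = (L : ℤ) - 1 := by
    rw [hr]; simp only [Pi.add_apply, Pi.smul_apply, boxVec, e_apply, if_true, smul_eq_mul, mul_one]; omega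
  unfold dsliceDir
  rw [if_pos ⟨rfl, hb, hres⟩, perp_res_sliceBond hL y κ r]

/-- The dressed slice direction of a skew value at unitary data is skew. [folklore] -/
theorem isSkewDir_dsliceDir [Nonempty n] (L : ℕ) {V : Site d → Fin d → (Matrix n n ℂ)ˣ} (hV : IsUnitaryCfg V) (y : Site d)
    (κ : Fin d) {m : Matrix n n ℂ} (hm : m ∈ skewAdjoint (Matrix n n ℂ)) : IsSkewDir (dsliceDir L V y κ m) := by
  intro z i
  unfold dsliceDir
  split_ifs
  · exact Ad_mem_skewAdjoint ((unitaryUnits _).inv_mem (hol_mem_of hV _ _)) hm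
  · exact (skewAdjoint _).zero_mem

/-! ## §2 The loop term of (42) for the dressed slice direction -/

/-- THE TAIL LOOP of the contour through `x = Ly + r`: `G_r = U_r⁻¹·T_{b_r}` with `U_r = V([b_r₊, q′+r] ∪ Γ_{q′,q′+r}⁻¹)`
(the rest of `Γ_{c,x}` after the slice bond) and `T_{b_r} = V(Γ_{q′,q′+r_⊥})⁻¹`. [folklore] -/
def tailLoop (L : ℕ) (V : Site d → Fin d → (Matrix n n ℂ)ˣ) (y : Site d) (κ : Fin d) (r : Fin d → Fin L) : (Matrix n n ℂ)ˣ :=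
  (hol V ((L : ℤ) • y + boxVec L r + (((L - 1 - (r κ : ℕ) : ℕ) : ℤ) + 1) • e κ)
      (seg κ ((r κ : ℕ) : ℤ) ++ revWord (treeWord (boxVec L r))))⁻¹
    * (hol V ((L : ℤ) • (y + e κ)) (treeWord (perp κ (boxVec L r))))⁻¹

omit [Fintype n] [DecidableEq n] in
/-- The straight part of a contour splits at the slice: `seg κ L = seg κ (j₀+1) ++ seg κ r_κ`, `j₀ = L − 1 − r_κ`. [folklore] -/
theorem seg_split {L : ℕ} (κ : Fin d) (r : Fin d → Fin L) :
    seg κ (L : ℤ) = seg κ ((((L - 1 - (r κ : ℕ) : ℕ) : ℤ)) + 1) ++ seg κ ((r κ : ℕ) : ℤ) := by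
  have hrκ : (r κ : ℕ) < L := (r κ).isLt
  rw [show (((L - 1 - (r κ : ℕ) : ℕ) : ℤ)) + 1 = ((L - (r κ : ℕ) : ℕ) : ℤ) by omega, seg_natCast, seg_natCast, seg_natCast,
    ← List.replicate_add, show L - (r κ : ℕ) + (r κ : ℕ) = L by omega]

/-- **THE DRESSED LOOP TERM OF (42) FOR THE DRESSED SLICE DIRECTION**: for every block point `x = Ly + r`,
`Ad_{W_x⁻¹}(δ_ψV)(Γ_{c,x} ∪ (−Γ_c)) = Ad_{V(Γ_c)}(Ad_{G_r} m − m)` with `G_r = tailLoop`. [cite: Balaban1985Averaging, (42) p.23] -/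
theorem loop_term_dsliceDir {L : ℕ} (hL : 1 ≤ L) (V : Site d → Fin d → (Matrix n n ℂ)ˣ) (y : Site d) (κ : Fin d)
    (m : Matrix n n ℂ) (r : Fin d → Fin L) :
    Ad (Wcx L V ((L : ℤ) • y) κ (boxVec L r))⁻¹
        (dhol V (dsliceDir L V y κ m) ((L : ℤ) • y) (loopWord L κ (boxVec L r)))
      = Ad (hol V ((L : ℤ) • y) (seg κ (L : ℤ))) (Ad (tailLoop L V y κ r) m - m) := by
  rw [Ad_inv_Wcx_dhol_loopWord_slice hL (sliceSupported_dsliceDir L V y κ m) y κ r, dsliceDir_faceSite hL,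
    dsliceDir_sliceBond hL, ← Ad_mul, Ad_sub, ← Ad_mul]
  congr 1
  congr 1
  -- the unit identity `W⁻¹·V(tree ++ seg_{j₀+1})·T = V(Γ_c)·(U⁻¹·T)`
  have hγ : gammaWord L κ (boxVec L r)
      = (treeWord (boxVec L r) ++ seg κ ((((L - 1 - (r κ : ℕ) : ℕ) : ℤ)) + 1))
        ++ (seg κ ((r κ : ℕ) : ℤ) ++ revWord (treeWord (boxVec L r))) := by
    rw [gammaWord, seg_split κ r]; simp only [List.append_assoc]
  have hdisp : (L : ℤ) • y + disp (treeWord (boxVec L r) ++ seg κ ((((L - 1 - (r κ : ℕ) : ℕ) : ℤ)) + 1))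
      = (L : ℤ) • y + boxVec L r + ((((L - 1 - (r κ : ℕ) : ℕ) : ℤ)) + 1) • e κ := by
    rw [disp_append, disp_treeWord, disp_seg, add_assoc]
  have hhol : hol V ((L : ℤ) • y) (gammaWord L κ (boxVec L r))
      = hol V ((L : ℤ) • y) (treeWord (boxVec L r) ++ seg κ ((((L - 1 - (r κ : ℕ) : ℕ) : ℤ)) + 1))
        * hol V ((L : ℤ) • y + boxVec L r + ((((L - 1 - (r κ : ℕ) : ℕ) : ℤ)) + 1) • e κ)
          (seg κ ((r κ : ℕ) : ℤ) ++ revWord (treeWord (boxVec L r))) := by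
    rw [hγ, hol_append, hdisp]
  unfold tailLoop
  rw [Wcx, hhol]
  group

/-- **THE TAIL LOOP IS AN AXIAL-GAUGE SEGMENT HOLONOMY**: with `q′ = L(y + e_κ)` and `g` the axial gauge at `q′`
(`B7Prop1Explicit.axialFn`), `G_r = V^g([q′ + r, q′ + r_⊥])` — the holonomy in the gauge `g` of the downward `κ`-segment of
`r_κ` bonds from `q′ + r`. [folklore] -/
theorem tailLoop_eq_hol_gaugeAct {L : ℕ} (V : Site d → Fin d → (Matrix n n ℂ)ˣ) (y : Site d) (κ : Fin d)
    (r : Fin d → Fin L) :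
    tailLoop L V y κ r
      = hol (gaugeAct (axialFn V ((L : ℤ) • (y + e κ))) V) ((L : ℤ) • (y + e κ) + boxVec L r) (seg κ (-((r κ : ℕ) : ℤ))) := by
  have hrκ : (r κ : ℕ) < L := (r κ).isLt
  -- the end point of the slice bond: `q′ + r_⊥`; `q′ + r = (q′ + r_⊥) + r_κ e_κ`
  have hend : (L : ℤ) • y + boxVec L r + ((((L - 1 - (r κ : ℕ) : ℕ) : ℤ)) + 1) • e κ
      = (L : ℤ) • (y + e κ) + perp κ (boxVec L r) := by
    rw [smul_add, perp, show (((L - 1 - (r κ : ℕ) : ℕ) : ℤ)) + 1 = (L : ℤ) - ((r κ : ℕ) : ℤ) by omega]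
    have : (boxVec L r) κ = ((r κ : ℕ) : ℤ) := rfl
    rw [this, sub_smul]
    abel
  have hpr : (L : ℤ) • (y + e κ) + perp κ (boxVec L r) + ((r κ : ℕ) : ℤ) • e κ = (L : ℤ) • (y + e κ) + boxVec L r := by
    rw [perp, show (boxVec L r) κ = ((r κ : ℕ) : ℤ) from rfl]; abel
  have hdn : (L : ℤ) • (y + e κ) + boxVec L r + -((r κ : ℕ) : ℤ) • e κ = (L : ℤ) • (y + e κ) + perp κ (boxVec L r) := by
    rw [perp, show (boxVec L r) κ = ((r κ : ℕ) : ℤ) from rfl, neg_smul]; abel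
  unfold tailLoop
  rw [hend, hol_append, disp_seg, hpr, hol_revWord' V (x := (L : ℤ) • (y + e κ)) _ _ (by rw [disp_treeWord]),
    hol_gaugeAct, disp_seg, hdn]
  simp only [axialFn, add_sub_cancel_left]
  -- `V([q′+r_⊥, q′+r])⁻¹ = V(reverse segment from q′ + r)`
  rw [← revWord_seg, hol_revWord' V (x := (L : ℤ) • (y + e κ) + perp κ (boxVec L r)) _ _ (by rw [disp_seg, hpr])]
  group

/-! ## §3 The tail loop is near the identity on a small field -/

/-- The axial gauge function is `U(N)`-valued for unitary data. [folklore] -/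
theorem axialFn_mem [Nonempty n] {V : Site d → Fin d → (Matrix n n ℂ)ˣ} (hV : IsUnitaryCfg V) (q x : Site d) :
    axialFn V q x ∈ unitaryUnits (Matrix n n ℂ) := hol_mem_of hV _ _

/-- The axially gauged configuration is `U(N)`-valued. [folklore] -/
theorem isUnitaryCfg_axialGauge [Nonempty n] {V : Site d → Fin d → (Matrix n n ℂ)ˣ} (hV : IsUnitaryCfg V) (q : Site d) :
    IsUnitaryCfg (gaugeAct (axialFn V q) V) := by
  intro x μ
  unfold gaugeAct
  exact (unitaryUnits _).mul_mem ((unitaryUnits _).mul_mem (axialFn_mem hV q x) (hV x μ))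
    ((unitaryUnits _).inv_mem (axialFn_mem hV q _))

/-- **`‖G_r − 1‖ ≤ d·L²·α` ON A SMALL FIELD**: every bond of the downward segment is an axial-gauge bond at `ℓ¹`-distance `≤ d·L`
from the gauge corner (`B7Prop1Explicit.axial_bond_bound`: within `d·L·α` of `1`), and there are `r_κ ≤ L` of them
(`AveragingDeficitNearIdentity.norm_hol_sub_one_le_of_bonds`). [folklore] -/
theorem norm_tailLoop_sub_one_le [Nonempty n] {L : ℕ} (hL : 1 ≤ L) {V : Site d → Fin d → (Matrix n n ℂ)ˣ} (hV : IsUnitaryCfg V)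
    {α : ℝ} (hα : 0 ≤ α) (hVa : SmallField V α) (y : Site d) (κ : Fin d) (r : Fin d → Fin L) :
    ‖((tailLoop L V y κ r : (Matrix n n ℂ)ˣ) : Matrix n n ℂ) - 1‖ ≤ d * (L : ℝ) ^ 2 * α := by
  rw [tailLoop_eq_hol_gaugeAct]
  set q' : Site d := (L : ℤ) • (y + e κ) with hq'
  set Vg := gaugeAct (axialFn V q') V with hVg
  have hVg : IsUnitaryCfg Vg := isUnitaryCfg_axialGauge hV q'
  have hU1 : ∀ x μ, V x μ ∈ U1 (Matrix n n ℂ) := fun x μ => mem_U1_of_unitary (hV x μ)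
  have hrκ : (r κ : ℕ) < L := (r κ).isLt
  -- every bond of the segment is within `d·L·α` of `1` in the axial gauge
  have hbond : ∀ b ∈ bondsOf (q' + boxVec L r) (seg κ (-((r κ : ℕ) : ℤ))), ‖((Vg b.1 b.2 : (Matrix n n ℂ)ˣ) : Matrix n n ℂ) - 1‖
      ≤ d * (L : ℝ) * α := by
    intro b hb
    obtain ⟨j, hj, rfl⟩ := (mem_bondsOf_seg_neg_iff _ κ (r κ : ℕ) b).mp hb
    have h := axial_bond_bound V hU1 q' (fun x κ μ hne => hVa x κ μ hne) hα (q' + boxVec L r - ((j : ℤ) + 1) • e κ) κ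
    refine h.trans (mul_le_mul_of_nonneg_right ?_ hα)
    -- `l1 (r − (j+1)e_κ) ≤ d·L`
    have e1 : q' + boxVec L r - ((j : ℤ) + 1) • e κ - q' = boxVec L r - ((j : ℤ) + 1) • e κ := by abel
    rw [e1]
    have hl : l1 (boxVec L r - ((j : ℤ) + 1) • e κ) ≤ d * L := by
      unfold l1
      calc ∑ i, ((boxVec L r - ((j : ℤ) + 1) • e κ) i).natAbs ≤ ∑ _i : Fin d, L := Finset.sum_le_sum fun i _ => by
              simp only [Pi.sub_apply, Pi.smul_apply, boxVec, e_apply, smul_eq_mul]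
              have := (r i).isLt
              split_ifs with h
              · subst h; omega
              · simp only [mul_zero, sub_zero, Int.natAbs_natCast]; omega
        _ = d * L := by simp
    exact_mod_cast hl
  have h := norm_hol_sub_one_le_of_bonds hVg (q' + boxVec L r) (seg κ (-((r κ : ℕ) : ℤ))) hbond
  rw [length_seg, Int.natAbs_neg, Int.natAbs_natCast] at h
  refine h.trans ?_
  have hr : ((r κ : ℕ) : ℝ) ≤ L := by exact_mod_cast hrκ.le
  have h0 : 0 ≤ (d : ℝ) * (L : ℝ) * α := by positivity
  calc ((r κ : ℕ) : ℝ) * (d * (L : ℝ) * α) ≤ (L : ℝ) * (d * (L : ℝ) * α) := mul_le_mul_of_nonneg_right hr h0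
    _ = d * (L : ℝ) ^ 2 * α := by ring

end

end Summit.QuantumFields.BalabanUV.T4Continuum.NE3DressedSliceLift
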